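import Summits.QuantumFields.YangMills.Theorems.UnitScaleTiltProp7CmapTwSCoarseColumn
import Summits.QuantumFields.YangMills.Theorems.UnitScaleTiltProp7SectET3WCurrentProp4RowsT3
import Literature.MathematicalPhysics.QuantumFieldTheory.Balaban1983to89.B11Eq90Transpose
import HarnessLib

/-!
# Route `UnitScaleTilt`, crux K1 child «MinimiserStabilityRegPr» (stmt-QuantumFields-19200), skeleton v10, stub `stub_existenceMinimalOrbit` (EX), route (α) — **«C-COLUMN-OF-157»:
# the EX display's column-letter binder `hCcol` (S16ᴰ ✓p685936 :141–146 = ★px6 g4's door ✓p684620 `theta_rows_family_of_columnLetters` :202–207, VERBATIM) AS A THEOREM from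
# ONE displayed print-faithful row — [Balaban1985Averaging] Prop. 5 (157) for the symmetric twisted chart of record `CmapTwS` AT ITS OWN ARGUMENT (exponent units, one bond
# direction, one constant `g L`) — by the (W-X′) chain rule, the read-set locality of ✓`Prop7CmapTwSReadSet`∕✓`Prop7CmapTwSCoarseColumn` and the `2d = 6` count; `G L := 6·g L`**

Cell `ym3-torus` (HUMAN RULING D-0037: YM₃ on the torus is ladder rung R3 — NOT d = 4, NOT infinite volume, NOT a mass gap, NOT Clay), width seat `ym3-torus-px18` (gen 3);
`--supports stmt-QuantumFields-19200 --as helper`; THEOREMS ONLY (0 `def`, 0 `sorry`); count-neutral.  CONDITIONAL door: the (157)-twˢ entry row stays a DISPLAYED hypothesis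
(its flat∕comb twins are theorems: lit ✓`B7Prop5General.prop5_general_157`, H side ✓`ChartKernelFlat.kernel157_flat`; the curved-`U₀` symmetric-stair letter is the honest
N06∕(157)-class residue, supported numerically by px18 g2's 157-LOCATE v2.1); nothing of EX, the stub or the crux is claimed.

THE PRINT.  [Balaban1985Averaging] p. 42, Prop. 5: «|(δ∕δA_b)C_k(U₀, A, c)| ≦ C₃|A| < C₃α₁ (157)» — in the `B = ηA` variables of lit ✓`prop5_general_157` at `j = k`:
`‖dC_k(B; Xδ_b)(c)‖ ≤ C₃·(Lᵏ)²·L^{−kd}·‖B‖·‖X‖`, i.e. at `d = 3` the per-entry letter `C₃·(Lᵏ)⁻¹·‖B‖·‖X‖`, and the derivative VANISHES unless `b ⊂ Bᵏ(c₋) ∪ Bᵏ(c₊)`.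
[Balaban1985Variational] p. 289 (72)–(73) (the kernel `𝔇(A′; c, b)` of `(δ∕δA′)C`), p. 291 (86) (its coarse columns feed `θ_E`), (115) p. 294 (the space `max{|A′|₍₋₁₎, |∇A′|₍₋₂₎}`).

THE DRESSING (design (W-X′), ✓`Prop7SectET3WCurrentProp4Rows.prop4Hyp_CmapTwS_conj_zeroJet`).  The display reads `C̃(A′) := (−I) • CmapTwS U₀ (((η:ℂ)·I) • ιA′)` on the member's
(115)-space, `ιA′ := fun b ↦ JetSup.equiv A′ (bondEquiv b)` the 0-jet (a continuous linear map, ✓`zeroJet_eq_clm`; `‖ιA′‖ ≤ ‖A′‖`, ✓`norm_zeroJet_le`), `η = L^{−(K−n)}`.  Chain rule: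
`(fderiv C̃ A (δ_bb X))(y) = (−I)·(fderiv (CmapTwS U₀) (ηI·ιA) (ηI·ι(δ_bb X)))(y)`, and `ι(δ_bb X)` is the one-bond direction at `bondEquiv⁻¹ bb` with value `X`; two factors `η` from
the two arguments turn the exponent-unit letter `g·(Lᵏ)⁻¹·‖B‖·‖δ‖` into the displayed `g·((Lᵏ)³)⁻¹·‖A′‖·‖X‖`.

WHAT IS PROVED (ns `…Theorems.Prop7CcolOf157Entry`; member letters `(F, n, K, h, U₀)`, `RegPr F n K ε₀ U₀` inside ✓`inputs_CmapTwS`' windows `10⁹L²e ≤ 1`, `10¹²L³ε₀ ≤ 1`).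
* §1 `zeroJet_single115_apply` (`ι(single115 bb X) b = X` if `bondEquiv b = bb`, else `0`), `zeroJet_single115_eq_zero_of_ne` (support on the one fine bond `bondEquiv⁻¹ bb`),
  `norm_zeroJet_single115_le` (`‖ι(single115 bb X)‖ ≤ ‖X‖`), `norm_dress_le` (`‖((η:ℂ)I) • ιA′‖ ≤ η·‖A′‖`).
* §2 ★ `fderiv_dressed_CmapTwS_apply` — THE CHAIN RULE at a point of the analyticity ball (`η·‖A‖ < e·η`): the display's entry IS `(−I)•` the raw entry at the dressed arguments;
  ★ `fderiv_dressed_CmapTwS_apply_eq_zero_of_not_incident` — it VANISHES at every coarse bond `y` NOT incident to the block point `B^{K−n}((bondEquiv⁻¹ bb)₋)`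
  (✓`fderiv_CmapTwS_apply_eq_zero_of_support_of_not_incident`); ★★ `norm_fderiv_dressed_CmapTwS_apply_le_of_157` — from the raw (157)-twˢ letter `g·(Lᵏ)⁻¹·‖B‖·‖δ‖` on
  `‖B‖ < r·η` to the dressed letter `g·((Lᵏ)³)⁻¹·‖A‖·‖X‖` on `‖A‖ < r`.
* §3 `sum_indicator_incident_le` — the indicator majorant of the `≤ 2d = 6` incident coarse bonds sums to `≤ 6·M` (✓`sum_le_of_support_incident` along ✓`bondShift`).
* §4 ★★★ **`hCcol_of_157_family`** — CONCLUSION: S16ᴰ's binder `hCcol` VERBATIM at `G := fun L ↦ 6 * g L`; HYPOTHESES: windows `hα hef hWe hWε` and `hdomC` (S16ᴰ :170 VERBATIM,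
  puts the dressed arguments in the analyticity ball `‖·‖ < ef L·η`), the sign `hg0`, and THE ONE DISPLAYED ROW
  «(157)-twˢ» `hC157 : ∀ L>1 i U₀, RegPr (α L) U₀ → ∀ B, ‖B‖ < (εC L + a₃ L)·η → ∀ b₀ δ, (δ = 0 off b₀) → ∀ c, ‖(fderiv ℂ (CmapTwS U₀) B δ) c‖ ≤ g L·((L:ℝ)^{K−n})⁻¹·‖B‖·‖δ‖`;
  also `hG0_of_hg0` (S16ᴰ's sign binder `hG0` at `G := 6g`).
HONEST SCOPE.  Re-lettering only (chain rule + locality + counting over landed theorems); the (157)-twˢ letter at curved `U₀` is NOT proved here and stays displayed; nothing of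
EX, the stub, the crux, d = 4 or the mass gap is claimed.

References: T. Bałaban, CMP **98** (1985) 17–51 [Balaban1985Averaging] (Prop. 5 (156)–(157) p.42, (110) p.34); CMP **102** (1985) 277–309 [Balaban1985Variational] ((44) p.285,
(72)–(73) p.289, (86) p.291, (115) p.294).
-/

set_option autoImplicit false

noncomputable section

namespace Summit.QuantumFields.YangMills.Theorems.Prop7CcolOf157Entry

open scoped Matrix.Norms.L2Operator BigOperators
open NormedSpace Metric Set
open Literature.MathematicalPhysics.QuantumFieldTheory.Balaban1983to89
open Literature.MathematicalPhysics.QuantumFieldTheory.Balaban1983to89.T3ContinuumYM3Torus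
open Literature.MathematicalPhysics.QuantumFieldTheory.Balaban1983to89.T3Thm1Carrier
open T3PrintedRegularMinimiser (RegPr)
open T3PrintedRegularOrbits (sites_eq)
open T3SectALandauChart (eta eta_pos)
open T3LevelShift (bondShift)
open B5Eq118OneStroke (iterBlockOf)
open B9SectCLatticeCarrier (Bond)
open B11Eq115Space (NegSup NegSize Space115 JetSup levWeight)
open B11Eq111FrakG (nabla115)
open B11Eq90Transpose (single115)
open Summit.QuantumFields.YangMills.Theorems.Prop7SectET3Transport (periodsT3 bondEquiv bgOfCfg cfgEquiv)
open Summit.QuantumFields.YangMills.Theorems.Prop7SymAvgTwSym (logChartTwS QTwS CmapTwS)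
open Summit.QuantumFields.YangMills.Theorems.Prop7CmapTwSymInputs (analyticOnNhd_logChartTwS)
open Summit.QuantumFields.YangMills.Theorems.Prop7CmapTwSCoarseColumn (fderiv_CmapTwS_apply_eq_zero_of_support_of_not_incident sum_le_of_support_incident)
open Summit.QuantumFields.YangMills.Theorems.Prop7SectET3WCurrentProp4Rows (zeroJet_eq_clm norm_zeroJet_le)

/-! ## §1 The 0-jet of a one-bond direction and the size of the dressed arguments -/

section ZeroJet

variable (F : T3Family) (n K : ℕ) [Fact (0 < (F.L : ℝ))] [Fact (0 < ((F.L : ℝ)⁻¹) ^ (K - n))]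
  (U₀ : GaugeField (F.P K) 0 (Matrix.specialUnitaryGroup (Fin 2) ℂ))

/-- The 0-jet of the one-bond direction `δ_bb X` read on the route carrier: `X` at the fine bond `bondEquiv⁻¹ bb`, `0` elsewhere. [cite: Balaban1985Variational, (90) p.291, (115) p.294] -/
theorem zeroJet_single115_apply (bb : Bond 3 (periodsT3 F K)) (X : Matrix (Fin 2) (Fin 2) ℂ) (b : PBond (F.P K) 0) :
    JetSup.equiv (levWeight (F.L : ℝ) (((F.L : ℝ)⁻¹) ^ (K - n)) (fun _ : Bond 3 (periodsT3 F K) => K - n) 1)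
        (levWeight (F.L : ℝ) (((F.L : ℝ)⁻¹) ^ (K - n)) (fun _ : Bond 3 (periodsT3 F K) × Fin 3 => K - n) 2) (nabla115 (((F.L : ℝ)⁻¹) ^ (K - n)) (bgOfCfg F K U₀))
        (single115 bb X) (bondEquiv F K b) = if bondEquiv F K b = bb then X else 0 := by
  have hs : JetSup.equiv (levWeight (F.L : ℝ) (((F.L : ℝ)⁻¹) ^ (K - n)) (fun _ : Bond 3 (periodsT3 F K) => K - n) 1)
        (levWeight (F.L : ℝ) (((F.L : ℝ)⁻¹) ^ (K - n)) (fun _ : Bond 3 (periodsT3 F K) × Fin 3 => K - n) 2) (nabla115 (((F.L : ℝ)⁻¹) ^ (K - n)) (bgOfCfg F K U₀))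
        (single115 bb X) = (Pi.single bb X : Bond 3 (periodsT3 F K) → Matrix (Fin 2) (Fin 2) ℂ) := rfl
  rw [hs]
  by_cases hb : bondEquiv F K b = bb
  · rw [if_pos hb, hb, Pi.single_eq_same]
  · rw [if_neg hb, Pi.single_eq_of_ne hb]

/-- … hence it VANISHES off the one fine bond `bondEquiv⁻¹ bb`. [cite: Balaban1985Variational, (90) p.291] -/
theorem zeroJet_single115_eq_zero_of_ne (bb : Bond 3 (periodsT3 F K)) (X : Matrix (Fin 2) (Fin 2) ℂ) {b : PBond (F.P K) 0} (hb : b ≠ (bondEquiv F K).symm bb) :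
    JetSup.equiv (levWeight (F.L : ℝ) (((F.L : ℝ)⁻¹) ^ (K - n)) (fun _ : Bond 3 (periodsT3 F K) => K - n) 1)
        (levWeight (F.L : ℝ) (((F.L : ℝ)⁻¹) ^ (K - n)) (fun _ : Bond 3 (periodsT3 F K) × Fin 3 => K - n) 2) (nabla115 (((F.L : ℝ)⁻¹) ^ (K - n)) (bgOfCfg F K U₀))
        (single115 bb X) (bondEquiv F K b) = 0 := by
  have hne : bondEquiv F K b ≠ bb := fun hbb => hb (by rw [← hbb, Equiv.symm_apply_apply])
  rw [zeroJet_single115_apply, if_neg hne]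

/-- `‖ι(δ_bb X)‖ ≤ ‖X‖` in the route's sup norm. [cite: Balaban1985Variational, (115) p.294] -/
theorem norm_zeroJet_single115_le (bb : Bond 3 (periodsT3 F K)) (X : Matrix (Fin 2) (Fin 2) ℂ) :
    ‖(fun b : PBond (F.P K) 0 => JetSup.equiv (levWeight (F.L : ℝ) (((F.L : ℝ)⁻¹) ^ (K - n)) (fun _ : Bond 3 (periodsT3 F K) => K - n) 1)
        (levWeight (F.L : ℝ) (((F.L : ℝ)⁻¹) ^ (K - n)) (fun _ : Bond 3 (periodsT3 F K) × Fin 3 => K - n) 2) (nabla115 (((F.L : ℝ)⁻¹) ^ (K - n)) (bgOfCfg F K U₀))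
        (single115 bb X) (bondEquiv F K b))‖ ≤ ‖X‖ := by
  refine (pi_norm_le_iff_of_nonneg (norm_nonneg X)).2 fun b => ?_
  rw [zeroJet_single115_apply]
  split_ifs
  · exact le_rfl
  · rw [norm_zero]; exact norm_nonneg X

omit [Fact (0 < (F.L : ℝ))] [Fact (0 < ((F.L : ℝ)⁻¹) ^ (K - n))] in
/-- `‖(η·I)‖ = η`. [cite: Balaban1985Variational, (2) p.278] -/
theorem norm_eta_mul_I : ‖(((eta F n K : ℝ) : ℂ)) * Complex.I‖ = eta F n K := by
  rw [norm_mul, Complex.norm_I, mul_one, Complex.norm_real, Real.norm_of_nonneg (eta_pos F n K).le]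

/-- **THE DRESSED POINT IS `η`-SMALL**: `‖((η:ℂ)I) • ιA′‖ ≤ η·‖A′‖₍₁₁₅₎` (the 0-jet is (115)-bounded at the member, ✓`norm_zeroJet_le`). [cite: Balaban1985Variational, (44) p.285, (115) p.294] -/
theorem norm_dress_le
    (A' : Space115 (F.L : ℝ) (((F.L : ℝ)⁻¹) ^ (K - n)) (fun _ : Bond 3 (periodsT3 F K) => K - n)
        (fun _ : Bond 3 (periodsT3 F K) × Fin 3 => K - n) (nabla115 (((F.L : ℝ)⁻¹) ^ (K - n)) (bgOfCfg F K U₀))) :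
    ‖((((eta F n K : ℝ) : ℂ)) * Complex.I) • (fun b : PBond (F.P K) 0 => JetSup.equiv _ _ _ A' (bondEquiv F K b))‖ ≤ eta F n K * ‖A'‖ := by
  rw [norm_smul, norm_eta_mul_I]
  exact mul_le_mul_of_nonneg_left (norm_zeroJet_le F n K U₀ A') (eta_pos F n K).le

/-- **THE DRESSED DIRECTION IS `η`-SMALL**: `‖((η:ℂ)I) • ι(δ_bb X)‖ ≤ η·‖X‖`. [cite: Balaban1985Variational, (90) p.291] -/
theorem norm_dress_single115_le (bb : Bond 3 (periodsT3 F K)) (X : Matrix (Fin 2) (Fin 2) ℂ) :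
    ‖((((eta F n K : ℝ) : ℂ)) * Complex.I) • (fun b : PBond (F.P K) 0 => JetSup.equiv (levWeight (F.L : ℝ) (((F.L : ℝ)⁻¹) ^ (K - n)) (fun _ : Bond 3 (periodsT3 F K) => K - n) 1)
        (levWeight (F.L : ℝ) (((F.L : ℝ)⁻¹) ^ (K - n)) (fun _ : Bond 3 (periodsT3 F K) × Fin 3 => K - n) 2) (nabla115 (((F.L : ℝ)⁻¹) ^ (K - n)) (bgOfCfg F K U₀))
        (single115 bb X) (bondEquiv F K b))‖ ≤ eta F n K * ‖X‖ := by
  rw [norm_smul, norm_eta_mul_I]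
  exact mul_le_mul_of_nonneg_left (norm_zeroJet_single115_le F n K U₀ bb X) (eta_pos F n K).le

end ZeroJet

/-! ## §2 The chain rule for the dressed chart remainder and the vanishing off the incident coarse bonds -/

section Chain

variable (F : T3Family) {n K : ℕ} (h : n ≤ K)
  {ε₀ e : ℝ} (hε₀ : 0 < ε₀) (he : 0 < e) (hWe : 10 ^ 9 * (F.L : ℝ) ^ 2 * e ≤ 1) (hWε : 10 ^ 12 * (F.L : ℝ) ^ 3 * ε₀ ≤ 1)
  (U₀ : GaugeField (F.P K) 0 (Matrix.specialUnitaryGroup (Fin 2) ℂ)) (hreg : RegPr F n K ε₀ U₀)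

include hε₀ he hWe hWε hreg in
/-- `C(U₀, ·) = log U̿^{twS} − Q(U₀)` is differentiable on the analyticity ball `‖B‖ < e·η` (✓`analyticOnNhd_logChartTwS`; `Q(U₀)` is linear). [cite: Balaban1985Variational, Prop. 3 p.289, (44) p.285] -/
theorem differentiableAt_CmapTwS {B : PBond (F.P K) 0 → Matrix (Fin 2) (Fin 2) ℂ} (hB : ‖B‖ < e * eta F n K) :
    DifferentiableAt ℂ (CmapTwS F n K h U₀) B := by
  have hd : DifferentiableAt ℂ (logChartTwS F n K h U₀) B :=
    (analyticOnNhd_logChartTwS F h hε₀ he hWe hWε U₀ hreg B (mem_ball_zero_iff.2 hB)).differentiableAt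
  have hfun : CmapTwS F n K h U₀ = logChartTwS F n K h U₀ - ⇑(QTwS F n K h U₀) := by
    funext A; rfl
  rw [hfun]
  exact hd.sub (QTwS F n K h U₀).differentiableAt

variable [Fact (0 < (F.L : ℝ))] [Fact (0 < ((F.L : ℝ)⁻¹) ^ (K - n))]

include hε₀ he hWe hWε hreg in
/-- ★ **THE (W-X′) CHAIN RULE**: at a point `A` of the member's (115)-space with `η·‖A‖ < e·η`, for every direction `δ`,
`(fderiv C̃ A δ)(y) = (−I)·(fderiv (C(U₀,·)) (ηI·ιA) (ηI·ιδ))(y)` — `C̃ = (−I) • C(U₀,·) ∘ (ηI • ι)` with `ι` the 0-jet CLM of ✓`zeroJet_eq_clm`.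
[cite: Balaban1985Variational, (44) p.285, (72) p.289, (115) p.294] -/
theorem fderiv_dressed_CmapTwS_apply
    {A : Space115 (F.L : ℝ) (((F.L : ℝ)⁻¹) ^ (K - n)) (fun _ : Bond 3 (periodsT3 F K) => K - n)
        (fun _ : Bond 3 (periodsT3 F K) × Fin 3 => K - n) (nabla115 (((F.L : ℝ)⁻¹) ^ (K - n)) (bgOfCfg F K U₀))}
    (hA : eta F n K * ‖A‖ < e * eta F n K)
    (δ : Space115 (F.L : ℝ) (((F.L : ℝ)⁻¹) ^ (K - n)) (fun _ : Bond 3 (periodsT3 F K) => K - n)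
        (fun _ : Bond 3 (periodsT3 F K) × Fin 3 => K - n) (nabla115 (((F.L : ℝ)⁻¹) ^ (K - n)) (bgOfCfg F K U₀))) (y : PBond (F.P n) 0) :
    fderiv ℂ (fun A' : Space115 (F.L : ℝ) (((F.L : ℝ)⁻¹) ^ (K - n)) (fun _ : Bond 3 (periodsT3 F K) => K - n)
          (fun _ : Bond 3 (periodsT3 F K) × Fin 3 => K - n) (nabla115 (((F.L : ℝ)⁻¹) ^ (K - n)) (bgOfCfg F K U₀)) =>
        (-Complex.I) • CmapTwS F n K h U₀ (((((eta F n K : ℝ) : ℂ)) * Complex.I) • (fun b : PBond (F.P K) 0 => JetSup.equiv _ _ _ A' (bondEquiv F K b)))) A δ y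
      = (-Complex.I) • fderiv ℂ (CmapTwS F n K h U₀)
          (((((eta F n K : ℝ) : ℂ)) * Complex.I) • (fun b : PBond (F.P K) 0 => JetSup.equiv _ _ _ A (bondEquiv F K b)))
          (((((eta F n K : ℝ) : ℂ)) * Complex.I) • (fun b : PBond (F.P K) 0 => JetSup.equiv _ _ _ δ (bondEquiv F K b))) y := by
  -- the dressing as ONE continuous linear map `ℓ = (ηI) • ι` (✓`zeroJet_eq_clm`)
  obtain ⟨ℓ, hℓA⟩ : ∃ ℓ : Space115 (F.L : ℝ) (((F.L : ℝ)⁻¹) ^ (K - n)) (fun _ : Bond 3 (periodsT3 F K) => K - n)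
        (fun _ : Bond 3 (periodsT3 F K) × Fin 3 => K - n) (nabla115 (((F.L : ℝ)⁻¹) ^ (K - n)) (bgOfCfg F K U₀)) →L[ℂ] (PBond (F.P K) 0 → Matrix (Fin 2) (Fin 2) ℂ),
      ∀ A' : Space115 (F.L : ℝ) (((F.L : ℝ)⁻¹) ^ (K - n)) (fun _ : Bond 3 (periodsT3 F K) => K - n)
        (fun _ : Bond 3 (periodsT3 F K) × Fin 3 => K - n) (nabla115 (((F.L : ℝ)⁻¹) ^ (K - n)) (bgOfCfg F K U₀)),
        ℓ A' = ((((eta F n K : ℝ) : ℂ)) * Complex.I) • (fun b : PBond (F.P K) 0 => JetSup.equiv _ _ _ A' (bondEquiv F K b)) :=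
    ⟨((((eta F n K : ℝ) : ℂ)) * Complex.I) •
      ((ContinuousLinearMap.pi fun b : PBond (F.P K) 0 =>
          ContinuousLinearMap.proj (R := ℂ) (φ := fun _ : Bond 3 (periodsT3 F K) => Matrix (Fin 2) (Fin 2) ℂ) (bondEquiv F K b)).comp
        ((NegSup.continuousLinearEquiv ℂ (levWeight (F.L : ℝ) (((F.L : ℝ)⁻¹) ^ (K - n)) (fun _ : Bond 3 (periodsT3 F K) => K - n) 1)).toContinuousLinearMap.comp
          (JetSup.fstCLM (levWeight (F.L : ℝ) (((F.L : ℝ)⁻¹) ^ (K - n)) (fun _ : Bond 3 (periodsT3 F K) => K - n) 1)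
            (levWeight (F.L : ℝ) (((F.L : ℝ)⁻¹) ^ (K - n)) (fun _ : Bond 3 (periodsT3 F K) × Fin 3 => K - n) 2)
            (nabla115 (((F.L : ℝ)⁻¹) ^ (K - n)) (bgOfCfg F K U₀))))),
      fun A' => rfl⟩
  have hfun : (fun A' : Space115 (F.L : ℝ) (((F.L : ℝ)⁻¹) ^ (K - n)) (fun _ : Bond 3 (periodsT3 F K) => K - n)
          (fun _ : Bond 3 (periodsT3 F K) × Fin 3 => K - n) (nabla115 (((F.L : ℝ)⁻¹) ^ (K - n)) (bgOfCfg F K U₀)) =>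
        (-Complex.I) • CmapTwS F n K h U₀ (((((eta F n K : ℝ) : ℂ)) * Complex.I) • (fun b : PBond (F.P K) 0 => JetSup.equiv _ _ _ A' (bondEquiv F K b))))
      = fun A' => (-Complex.I) • (CmapTwS F n K h U₀ ∘ ℓ) A' := by
    funext A'; rw [Function.comp_apply, hℓA]
  -- the point is in the analyticity ball
  have hB : ‖ℓ A‖ < e * eta F n K := by
    rw [hℓA]; exact (norm_dress_le F n K U₀ A).trans_lt hA
  have hdC : DifferentiableAt ℂ (CmapTwS F n K h U₀) (ℓ A) := differentiableAt_CmapTwS F h hε₀ he hWe hWε U₀ hreg hB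
  have hcomp : HasFDerivAt (CmapTwS F n K h U₀ ∘ ℓ) ((fderiv ℂ (CmapTwS F n K h U₀) (ℓ A)).comp ℓ) A :=
    hdC.hasFDerivAt.comp A ℓ.hasFDerivAt
  have hsm : HasFDerivAt (fun A' => (-Complex.I) • (CmapTwS F n K h U₀ ∘ ℓ) A') ((-Complex.I) • (fderiv ℂ (CmapTwS F n K h U₀) (ℓ A)).comp ℓ) A :=
    hcomp.const_smul (-Complex.I)
  rw [hfun, hsm.fderiv, FunLike.coe_smul, Pi.smul_apply, ContinuousLinearMap.comp_apply, hℓA, hℓA, Pi.smul_apply]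

include hε₀ he hWe hWε hreg in
/-- ★ **OFF THE INCIDENT COARSE BONDS THE DRESSED ENTRY VANISHES**: for `η·‖A‖ < e·η`, a fine bond `bb` of the lit lattice and a coarse bond `y` with NEITHER end of `ŷ = bondShift y`
equal to the block point `B^{K−n}((bondEquiv⁻¹ bb)₋)`, `(fderiv C̃ A (δ_bb X))(y) = 0` (chain rule + ✓`fderiv_CmapTwS_apply_eq_zero_of_support_of_not_incident`).
[cite: Balaban1985Variational, (72)–(73) p.289; Balaban1985Averaging, (110) p.34] -/
theorem fderiv_dressed_CmapTwS_apply_eq_zero_of_not_incident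
    {A : Space115 (F.L : ℝ) (((F.L : ℝ)⁻¹) ^ (K - n)) (fun _ : Bond 3 (periodsT3 F K) => K - n)
        (fun _ : Bond 3 (periodsT3 F K) × Fin 3 => K - n) (nabla115 (((F.L : ℝ)⁻¹) ^ (K - n)) (bgOfCfg F K U₀))}
    (hA : eta F n K * ‖A‖ < e * eta F n K) (bb : Bond 3 (periodsT3 F K)) (X : Matrix (Fin 2) (Fin 2) ℂ) (y : PBond (F.P n) 0)
    (hy : ¬ ((bondShift (sites_eq F n K h) y).src = iterBlockOf (K - n) ((bondEquiv F K).symm bb).src ∨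
            (bondShift (sites_eq F n K h) y).tgt = iterBlockOf (K - n) ((bondEquiv F K).symm bb).src)) :
    fderiv ℂ (fun A' : Space115 (F.L : ℝ) (((F.L : ℝ)⁻¹) ^ (K - n)) (fun _ : Bond 3 (periodsT3 F K) => K - n)
          (fun _ : Bond 3 (periodsT3 F K) × Fin 3 => K - n) (nabla115 (((F.L : ℝ)⁻¹) ^ (K - n)) (bgOfCfg F K U₀)) =>
        (-Complex.I) • CmapTwS F n K h U₀ (((((eta F n K : ℝ) : ℂ)) * Complex.I) • (fun b : PBond (F.P K) 0 => JetSup.equiv _ _ _ A' (bondEquiv F K b)))) A (single115 bb X) y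
      = 0 := by
  rw [fderiv_dressed_CmapTwS_apply F h hε₀ he hWe hWε U₀ hreg hA]
  have hB : ‖((((eta F n K : ℝ) : ℂ)) * Complex.I) • (fun b : PBond (F.P K) 0 => JetSup.equiv _ _ _ A (bondEquiv F K b))‖ < e * eta F n K :=
    (norm_dress_le F n K U₀ A).trans_lt hA
  rw [fderiv_CmapTwS_apply_eq_zero_of_support_of_not_incident F n K h hε₀ he hWe hWε U₀ hreg hB ((bondEquiv F K).symm bb) _ (fun b hb => ?_) y hy, smul_zero]
  rw [Pi.smul_apply, zeroJet_single115_eq_zero_of_ne F n K U₀ bb X hb, smul_zero]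

include hε₀ he hWe hWε hreg in
/-- ★★ **FROM THE RAW (157)-twˢ LETTER TO THE DRESSED LETTER**: if on `‖B‖ < r·η` every one-bond-supported direction `δ` has `‖(fderiv (C(U₀,·)) B δ)(c)‖ ≤ g·(Lᵏ)⁻¹·‖B‖·‖δ‖`
(print's (157) in `B`-variables at `j = k`, `d = 3`), and `r ≤ e`, then on `‖A‖ < r` the display's entry obeys `‖(fderiv C̃ A (δ_bb X))(y)‖ ≤ g·((Lᵏ)³)⁻¹·‖A‖·‖X‖` (two factors
`η = (Lᵏ)⁻¹` from the two dressed arguments). [cite: Balaban1985Averaging, Prop. 5 (157) p.42; Balaban1985Variational, (44) p.285, (72) p.289] -/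
theorem norm_fderiv_dressed_CmapTwS_apply_le_of_157 {r g : ℝ} (hg : 0 ≤ g) (hre : r ≤ e)
    (h157 : ∀ B : PBond (F.P K) 0 → Matrix (Fin 2) (Fin 2) ℂ, ‖B‖ < r * eta F n K →
      ∀ (b₀ : PBond (F.P K) 0) (δ : PBond (F.P K) 0 → Matrix (Fin 2) (Fin 2) ℂ), (∀ b, b ≠ b₀ → δ b = 0) →
      ∀ c : PBond (F.P n) 0, ‖fderiv ℂ (CmapTwS F n K h U₀) B δ c‖ ≤ g * ((F.L : ℝ) ^ (K - n))⁻¹ * ‖B‖ * ‖δ‖)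
    {A : Space115 (F.L : ℝ) (((F.L : ℝ)⁻¹) ^ (K - n)) (fun _ : Bond 3 (periodsT3 F K) => K - n)
        (fun _ : Bond 3 (periodsT3 F K) × Fin 3 => K - n) (nabla115 (((F.L : ℝ)⁻¹) ^ (K - n)) (bgOfCfg F K U₀))}
    (hA : ‖A‖ < r) (bb : Bond 3 (periodsT3 F K)) (X : Matrix (Fin 2) (Fin 2) ℂ) (y : PBond (F.P n) 0) :
    ‖fderiv ℂ (fun A' : Space115 (F.L : ℝ) (((F.L : ℝ)⁻¹) ^ (K - n)) (fun _ : Bond 3 (periodsT3 F K) => K - n)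
          (fun _ : Bond 3 (periodsT3 F K) × Fin 3 => K - n) (nabla115 (((F.L : ℝ)⁻¹) ^ (K - n)) (bgOfCfg F K U₀)) =>
        (-Complex.I) • CmapTwS F n K h U₀ (((((eta F n K : ℝ) : ℂ)) * Complex.I) • (fun b : PBond (F.P K) 0 => JetSup.equiv _ _ _ A' (bondEquiv F K b)))) A (single115 bb X) y‖
      ≤ g * (((F.L : ℝ) ^ (K - n)) ^ 3)⁻¹ * ‖A‖ * ‖X‖ := by
  have hη := eta_pos F n K
  have hA' : eta F n K * ‖A‖ < e * eta F n K := by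
    rw [mul_comm e]; exact mul_lt_mul_of_pos_left (hA.trans_le hre) hη
  rw [fderiv_dressed_CmapTwS_apply F h hε₀ he hWe hWε U₀ hreg hA', norm_smul, norm_neg, Complex.norm_I, one_mul]
  have hB : ‖((((eta F n K : ℝ) : ℂ)) * Complex.I) • (fun b : PBond (F.P K) 0 => JetSup.equiv _ _ _ A (bondEquiv F K b))‖ < r * eta F n K := by
    refine (norm_dress_le F n K U₀ A).trans_lt ?_
    rw [mul_comm r]; exact mul_lt_mul_of_pos_left hA hη
  refine (h157 _ hB ((bondEquiv F K).symm bb) _ (fun b hb => ?_) y).trans ?_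
  · rw [Pi.smul_apply, zeroJet_single115_eq_zero_of_ne F n K U₀ bb X hb, smul_zero]
  · have hηL : eta F n K = ((F.L : ℝ) ^ (K - n))⁻¹ := by rw [T3SectALandauChart.eta, inv_pow]
    have hLk : 0 < ((F.L : ℝ) ^ (K - n))⁻¹ := by rw [← hηL]; exact hη
    have h1 := norm_dress_le F n K U₀ A
    have h2 := norm_dress_single115_le F n K U₀ bb X
    have hgc : 0 ≤ g * ((F.L : ℝ) ^ (K - n))⁻¹ := mul_nonneg hg hLk.le
    calc _ ≤ g * ((F.L : ℝ) ^ (K - n))⁻¹ * (eta F n K * ‖A‖) * (eta F n K * ‖X‖) :=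
          mul_le_mul (mul_le_mul_of_nonneg_left h1 hgc) h2 (norm_nonneg _) (mul_nonneg hgc (mul_nonneg hη.le (norm_nonneg _)))
      _ = g * (((F.L : ℝ) ^ (K - n)) ^ 3)⁻¹ * ‖A‖ * ‖X‖ := by rw [hηL]; ring

end Chain

/-! ## §3 Counting: the indicator majorant of the incident coarse bonds -/

section Count

variable (F : T3Family) (n K : ℕ) (h : n ≤ K)

/-- **THE INDICATOR MAJORANT SUMS TO `≤ 6·M`**: for a fine bond `b₀` and `M ≥ 0`, `Σ_{y ∈ T^{(n)} bonds} (if ŷ is incident to B^{K−n}(b₀₋) then M else 0) ≤ 6·M` — at most `2d = 6` bonds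
of the comparison torus are incident to a site (✓`sum_le_of_support_incident` along ✓`bondShift`). [folklore] -/
theorem sum_indicator_incident_le (b₀ : PBond (F.P K) 0) {M : ℝ} (hM : 0 ≤ M) :
    ∑ y : PBond (F.P n) 0,
        (if (bondShift (sites_eq F n K h) y).src = iterBlockOf (K - n) b₀.src ∨ (bondShift (sites_eq F n K h) y).tgt = iterBlockOf (K - n) b₀.src then M else 0)
      ≤ 6 * M := by
  have hsum : ∑ y : PBond (F.P n) 0,
        (if (bondShift (sites_eq F n K h) y).src = iterBlockOf (K - n) b₀.src ∨ (bondShift (sites_eq F n K h) y).tgt = iterBlockOf (K - n) b₀.src then M else 0)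
      = ∑ c' : PBond (F.P K) (K - n), (if c'.src = iterBlockOf (K - n) b₀.src ∨ c'.tgt = iterBlockOf (K - n) b₀.src then M else 0) :=
    Fintype.sum_equiv (bondShift (sites_eq F n K h)) _ _ fun c => rfl
  rw [hsum]
  have hd : ((F.P K).d : ℝ) = 3 := by norm_num [T3Family.P_d]
  have hmain := sum_le_of_support_incident (iterBlockOf (K - n) b₀.src)
    (g := fun c' : PBond (F.P K) (K - n) => if c'.src = iterBlockOf (K - n) b₀.src ∨ c'.tgt = iterBlockOf (K - n) b₀.src then M else 0) hM
    (fun c' => by split_ifs; exacts [le_rfl, hM])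
    (fun c' hc' => by rw [if_neg hc'])
  rw [hd] at hmain
  linarith

end Count

/-! ## §4 ★★★ The door: S16ᴰ's `hCcol` from the one displayed (157)-twˢ row -/

/-- S16ᴰ's sign binder `hG0` at `G := 6·g`. [folklore] -/
theorem hG0_of_hg0 (g : ℕ → ℝ) (hg0 : ∀ L : ℕ, 1 < L → 0 ≤ g L) : ∀ L : ℕ, 1 < L → 0 ≤ 6 * g L :=
  fun L hL => mul_nonneg (by norm_num) (hg0 L hL)

/-- ★★★ **«C-COLUMN-OF-157»: the EX display's binder `hCcol` (S16ᴰ ✓p685936 :141–146 = ✓p684620 :202–207, VERBATIM) at `G := fun L ↦ 6 * g L`, from THE ONE DISPLAYED ROW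
«(157)-twˢ» at `CmapTwS`'s own argument** — [Balaban1985Averaging] Prop. 5 (157) in the `B`-variables at `j = k`, `d = 3`, for the symmetric twisted chart of record at the
curved background: `‖(fderiv ℂ (C(U₀,·)) B δ)(c)‖ ≤ g L·(L^{K−n})⁻¹·‖B‖·‖δ‖` for `‖B‖ < (εC L + a₃ L)·η` and `δ` supported on one fine bond (DISPLAYED; flat∕comb twins
✓`prop5_general_157`, ✓`kernel157_flat`) — plus the windows `hα hef hWe hWε`, S16ᴰ's `hdomC` (the dressed arguments sit in the analyticity ball `‖·‖ < ef L·η`) and the sign `hg0`.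
Inside: `gC y bb := if ŷ is incident to B^{K−n}((bondEquiv⁻¹ bb)₋) then g L·((L^{K−n})³)⁻¹ else 0` — entries by §2 (chain rule ∕ vanishing), column by §3 (`2d = 6`).
[cite: Balaban1985Averaging, Prop. 5 (157) p.42, (110) p.34; Balaban1985Variational, (44) p.285, (72)–(73) p.289, (86) p.291, (115) p.294] -/
theorem hCcol_of_157_family
    [hFL : ∀ F : T3Family, Fact (0 < (F.L : ℝ))] [hFη : ∀ (F : T3Family) (k : ℕ), Fact (0 < ((F.L : ℝ)⁻¹) ^ k)]
    (α a₃ εC ef g : ℕ → ℝ)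
    (hα : ∀ L, 1 < L → 0 < α L) (hef : ∀ L, 1 < L → 0 < ef L)
    (hWe : ∀ L : ℕ, 1 < L → 10 ^ 9 * (L : ℝ) ^ 2 * ef L ≤ 1) (hWε : ∀ L : ℕ, 1 < L → 10 ^ 12 * (L : ℝ) ^ 3 * α L ≤ 1)
    -- S16ᴰ's window (117)∕(121)-class, VERBATIM :170 — puts `η·(εC + a₃) < ef·η`
    (hdomC : ∀ L : ℕ, 1 < L → 2 * (εC L + a₃ L) ≤ ef L / 2)
    (hg0 : ∀ L : ℕ, 1 < L → 0 ≤ g L)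
    -- THE ONE DISPLAYED ROW «(157)-twˢ» ([Balaban1985Averaging] Prop. 5 (157), B-variables, j = k, d = 3; the symmetric-stair letter at curved `U₀` — N06∕(157)-class)
    (hC157 : ∀ (L : ℕ), 1 < L → ∀ (i : Idx L) (U₀ : GaugeField (i.1.1.P i.1.2.2) 0 (Matrix.specialUnitaryGroup (Fin 2) ℂ)), RegPr i.1.1 i.1.2.1 i.1.2.2 (α L) U₀ →
      ∀ B : PBond (i.1.1.P i.1.2.2) 0 → Matrix (Fin 2) (Fin 2) ℂ, ‖B‖ < (εC L + a₃ L) * eta i.1.1 i.1.2.1 i.1.2.2 →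
      ∀ (b₀ : PBond (i.1.1.P i.1.2.2) 0) (δ : PBond (i.1.1.P i.1.2.2) 0 → Matrix (Fin 2) (Fin 2) ℂ), (∀ b, b ≠ b₀ → δ b = 0) →
      ∀ c : PBond (i.1.1.P i.1.2.1) 0, ‖fderiv ℂ (CmapTwS i.1.1 i.1.2.1 i.1.2.2 i.2.2.le U₀) B δ c‖ ≤ g L * ((L : ℝ) ^ (i.1.2.2 - i.1.2.1))⁻¹ * ‖B‖ * ‖δ‖) :
    -- CONCLUSION = S16ᴰ's `hCcol` VERBATIM at `G := fun L ↦ 6 * g L` (β-reduced: `G L` reads `6 * g L`)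
    (∀ (L : ℕ), 1 < L → ∀ (i : Idx L) (U₀ : GaugeField (i.1.1.P i.1.2.2) 0 (Matrix.specialUnitaryGroup (Fin 2) ℂ)), RegPr i.1.1 i.1.2.1 i.1.2.2 (α L) U₀ →
      ∃ gC : PBond (i.1.1.P i.1.2.1) 0 → Bond 3 (periodsT3 i.1.1 i.1.2.2) → ℝ, (∀ y bb, 0 ≤ gC y bb) ∧
        (∀ A : Space115 (i.1.1.L : ℝ) (((i.1.1.L : ℝ)⁻¹) ^ (i.1.2.2 - i.1.2.1)) (fun _ : Bond 3 (periodsT3 i.1.1 i.1.2.2) => i.1.2.2 - i.1.2.1) (fun _ : Bond 3 (periodsT3 i.1.1 i.1.2.2) × Fin 3 => i.1.2.2 - i.1.2.1) (nabla115 (((i.1.1.L : ℝ)⁻¹) ^ (i.1.2.2 - i.1.2.1)) (bgOfCfg i.1.1 i.1.2.2 U₀)), ‖A‖ < εC L + a₃ L → ∀ (bb : Bond 3 (periodsT3 i.1.1 i.1.2.2)) (X : Matrix (Fin 2) (Fin 2) ℂ) (y : PBond (i.1.1.P i.1.2.1) 0),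
          ‖fderiv ℂ (fun A' : Space115 (i.1.1.L : ℝ) (((i.1.1.L : ℝ)⁻¹) ^ (i.1.2.2 - i.1.2.1)) (fun _ : Bond 3 (periodsT3 i.1.1 i.1.2.2) => i.1.2.2 - i.1.2.1) (fun _ : Bond 3 (periodsT3 i.1.1 i.1.2.2) × Fin 3 => i.1.2.2 - i.1.2.1) (nabla115 (((i.1.1.L : ℝ)⁻¹) ^ (i.1.2.2 - i.1.2.1)) (bgOfCfg i.1.1 i.1.2.2 U₀)) =>
          (-Complex.I) • CmapTwS i.1.1 i.1.2.1 i.1.2.2 i.2.2.le U₀ (((((eta i.1.1 i.1.2.1 i.1.2.2 : ℝ) : ℂ)) * Complex.I) • (fun b : PBond (i.1.1.P i.1.2.2) 0 => JetSup.equiv _ _ _ A' (bondEquiv i.1.1 i.1.2.2 b)))) A (single115 bb X) y‖ ≤ gC y bb * ‖A‖ * ‖X‖) ∧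
        (∀ bb : Bond 3 (periodsT3 i.1.1 i.1.2.2), ∑ y : PBond (i.1.1.P i.1.2.1) 0, gC y bb ≤ 6 * g L * (((L : ℝ) ^ (i.1.2.2 - i.1.2.1)) ^ 3)⁻¹)) := by
  intro L hL i U₀ hregα
  have hLi : (L : ℝ) = (i.1.1.L : ℝ) := by rw [i.2.1]
  have hWe' : 10 ^ 9 * (i.1.1.L : ℝ) ^ 2 * ef L ≤ 1 := by rw [← hLi]; exact hWe L hL
  have hWε' : 10 ^ 12 * (i.1.1.L : ℝ) ^ 3 * α L ≤ 1 := by rw [← hLi]; exact hWε L hL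
  have hre : εC L + a₃ L ≤ ef L := by linarith [hdomC L hL, (hef L hL).le]
  have hVpos : 0 ≤ (((L : ℝ) ^ (i.1.2.2 - i.1.2.1)) ^ 3)⁻¹ := by positivity
  have hM : 0 ≤ g L * (((L : ℝ) ^ (i.1.2.2 - i.1.2.1)) ^ 3)⁻¹ := mul_nonneg (hg0 L hL) hVpos
  -- the raw row at this member, the volume letter's `L` read as the member's `L`
  have h157 : ∀ B : PBond (i.1.1.P i.1.2.2) 0 → Matrix (Fin 2) (Fin 2) ℂ, ‖B‖ < (εC L + a₃ L) * eta i.1.1 i.1.2.1 i.1.2.2 →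
      ∀ (b₀ : PBond (i.1.1.P i.1.2.2) 0) (δ : PBond (i.1.1.P i.1.2.2) 0 → Matrix (Fin 2) (Fin 2) ℂ), (∀ b, b ≠ b₀ → δ b = 0) →
      ∀ c : PBond (i.1.1.P i.1.2.1) 0, ‖fderiv ℂ (CmapTwS i.1.1 i.1.2.1 i.1.2.2 i.2.2.le U₀) B δ c‖ ≤ g L * ((i.1.1.L : ℝ) ^ (i.1.2.2 - i.1.2.1))⁻¹ * ‖B‖ * ‖δ‖ := by
    rw [← hLi]; exact hC157 L hL i U₀ hregα
  -- the majorant: the dressed (157) letter on the `≤ 6` incident coarse bonds, `0` elsewhere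
  obtain ⟨gC, hgC⟩ : ∃ gC : PBond (i.1.1.P i.1.2.1) 0 → Bond 3 (periodsT3 i.1.1 i.1.2.2) → ℝ, ∀ y bb, gC y bb =
      if (bondShift (sites_eq i.1.1 i.1.2.1 i.1.2.2 i.2.2.le) y).src = iterBlockOf (i.1.2.2 - i.1.2.1) ((bondEquiv i.1.1 i.1.2.2).symm bb).src ∨
          (bondShift (sites_eq i.1.1 i.1.2.1 i.1.2.2 i.2.2.le) y).tgt = iterBlockOf (i.1.2.2 - i.1.2.1) ((bondEquiv i.1.1 i.1.2.2).symm bb).src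
        then g L * (((L : ℝ) ^ (i.1.2.2 - i.1.2.1)) ^ 3)⁻¹ else 0 :=
    ⟨fun y bb => if (bondShift (sites_eq i.1.1 i.1.2.1 i.1.2.2 i.2.2.le) y).src = iterBlockOf (i.1.2.2 - i.1.2.1) ((bondEquiv i.1.1 i.1.2.2).symm bb).src ∨
          (bondShift (sites_eq i.1.1 i.1.2.1 i.1.2.2 i.2.2.le) y).tgt = iterBlockOf (i.1.2.2 - i.1.2.1) ((bondEquiv i.1.1 i.1.2.2).symm bb).src
        then g L * (((L : ℝ) ^ (i.1.2.2 - i.1.2.1)) ^ 3)⁻¹ else 0, fun _ _ => rfl⟩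
  refine ⟨gC, fun y bb => ?_, fun A hA bb X y => ?_, fun bb => ?_⟩
  · -- signs
    rw [hgC]; split_ifs; exacts [hM, le_rfl]
  · -- entries: incident ⇒ the dressed (157) letter (§2); not incident ⇒ the entry vanishes (§2)
    rw [hgC]
    split_ifs with hy
    · exact (norm_fderiv_dressed_CmapTwS_apply_le_of_157 i.1.1 i.2.2.le (hα L hL) (hef L hL) hWe' hWε' U₀ hregα (hg0 L hL) hre h157 hA bb X y).trans
        (le_of_eq (by rw [hLi]))
    · have hη := eta_pos i.1.1 i.1.2.1 i.1.2.2
      have hA' : eta i.1.1 i.1.2.1 i.1.2.2 * ‖A‖ < ef L * eta i.1.1 i.1.2.1 i.1.2.2 := by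
        rw [mul_comm (ef L)]; exact mul_lt_mul_of_pos_left (hA.trans_le hre) hη
      rw [fderiv_dressed_CmapTwS_apply_eq_zero_of_not_incident i.1.1 i.2.2.le (hα L hL) (hef L hL) hWe' hWε' U₀ hregα hA' bb X y hy,
        norm_zero, zero_mul, zero_mul]
  · -- the coarse column: at most `2d = 6` incident bonds (§3)
    simp only [hgC]
    exact (sum_indicator_incident_le i.1.1 i.1.2.1 i.1.2.2 i.2.2.le ((bondEquiv i.1.1 i.1.2.2).symm bb) hM).trans (le_of_eq (by ring))

end Summit.QuantumFields.YangMills.Theorems.Prop7CcolOf157Entry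

end
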